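import Summits.QuantumFields.YangMills.Theorems.UnitScaleTiltProp7SymAvgTwGaugeDir
import Summits.QuantumFields.YangMills.Theorems.UnitScaleTiltProp7QSymFlat
import Summits.QuantumFields.YangMills.Theorems.UnitScaleTiltProp7CombFramesFlatPureGauge
import Summits.QuantumFields.YangMills.Theorems.UnitScaleTiltProp7SymAvgRelDiffT3
import Summits.QuantumFields.YangMills.Theorems.UnitScaleTiltProp7SymAvgTwFrameDiff
import HarnessLib

/-!
# `UnitScaleTiltProp7CombChartFlatPureGauge` — THE TWISTED (COMB-FRAME) CHART OF A FLAT PURE GAUGE ON T³ IS THE COARSE PURE GAUGE OF THE AVERAGED GAUGE TRANSFORMATION: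
# `U̿^{tw}(A)(c) = ū(c₋)⁻¹·ū(c₊)` EXACTLY whenever `e^{A} = 1^{g}`, `ū := (R̄₀(g♯⁻¹))^{(K−n)} ∘ coordT3`; hence **`QTw 1 (D(1)λ)(c) = (Q′_{K−n}(−λ♯))(z c₊) − (Q′_{K−n}(−λ♯))(z c₋)`** —
# print's (3.115) «Q_jDλ = D̄ʲQ′_jλ» AT THE FLAT MEMBER for the route's twisted average `QTw`: its gauge parameter is a BOX MEAN (print's corner-anchored box at `x̂`), not the base-point value
(route `UnitScaleTilt`, crux K1 «MinimiserStabilityRegPr» stmt-QuantumFields-19200; ★★OWNER ym3-torus-plan g29 RULING №17 (2) «COMB-FLAT COERCIVITY», pen px6 g5; item (I1b) of the LOCATE memo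
`LOCATE-COMBFLAT-px6g5.md` (19200 evidence #60) — the torus half of row (hR) of ✓`Prop7LaplaceAcFlatTransfer.coercive_laplaceAc_one_of_sliceBound`; def-free, count-neutral).
Cell `ym3-torus` (HUMAN RULING D-0037, YM ladder rung R3 — YM₃ on T³ is a rung, not d = 4, not a mass gap, not Clay), width seat `ym3-torus-px6` (gen 5).

THE PRINT.  [Balaban1985BackgroundPropagators] p.418: «we calculate it for U′^u with U′ = 1 … R_yU′‾ = u(y)(R̄u)⁻¹(y), hence Ū′_c = (R̄u)(c₋)R̄_c(R̄u)⁻¹(c₊). Taking logarithms of both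
sides, and linear parts in λ, we obtain (QD^{L⁻¹}λ)(c) = (D_ŪQ′λ)(c). (3.114) Iterating this identity we obtain finally Q_jDλ = D̄ʲQ′_jλ (3.115) … they imply that the average QA are
invariant with respect to gauge transformations λ satisfying Q′λ = 0, i.e. λ ∈ N(Q′)»; (3.19) p.393, p.394 «Q′_j(U) are linear parts of the averaging operations R̄uʲ».  [Balaban1985Averaging]
(84)–(88) pp.30–31.
WHAT IS PROVED (sorry-free, no definition; `x₀ = basePt F n K`, `x̂ y = embIter (K−n) (siteShift y)`, `z y = coordT3 y`, `g♯ = pullGauge g x₀`, `L = (F.P K).L`; the ONLY displayed hypothesis is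
the differentiability of the twisted log-chart at `0` in §3, supplied at the trivially regular `U₀ = 1` by ✓`Prop7SymAvgTwBridge.hasFDerivAt_logChartTw` ∘ ✓`Prop7SymAvgTwFrameDiff`):
* §1 `pull_const_one`; ★ `frameTw_one_of_gaugeActT` — if `e^{A}·1 = 1^{g}` bondwise then `w_A(y) = g(x̂ y) · (R̄₀(g♯⁻¹))^{(K−n)}(z y)` (✓`Prop7CombFramesFlatPureGauge.wrec_one_gaugeAct` through
  ✓`B8Thm2SetupTorus.pull_gaugeActT_eq` and ✓`Prop7AxialReprPrint.embIter_eq_transl`); `descendToGL_one_of_gaugeActT` — `D̄_GL(1^{g})(c) = g(x̂c₋)·g(x̂c₊)⁻¹` (✓`descendToGL_gaugeActT`, ✓`descendToGL_one`).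
* §2 ★★★ **`dbarTw_one_of_gaugeActT`** — `U̿^{tw}(A)(c) = ū(c₋)⁻¹ · ū(c₊)`, `ū y := uavg L 1 (g♯)⁻¹ (K−n) (z y)`: the base-point factors `g(x̂·)` CANCEL between the comb frames and the
  pinned-covariant inner average; `logChartTw_one_of_gaugeActT` — `log U̿^{tw}(A)(c) = log(ū(c₋)⁻¹ū(c₊))`.  Exact, non-linear, no smallness.
* §3 ★★★ **`QTw_one_gaugeDir`** — `QTw F n K h 1 (b ↦ λ(b₋) − λ(b₊)) = c ↦ (Q′(−λ♯))(z c₊) − (Q′(−λ♯))(z c₋)`, `Q′ := B9Eq3114Proof.P12.QpIter L 1 · (K−n)` the iterated block mean of the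
  pulled-back parameter (chain rule along the gauge curve `g_t = e^{tλ}` as in ✓`Prop7QSymGaugeCovariance.QSym_gaugeDir`; ✓`Prop7CombFramesFlatPureGauge.hasDerivAt_uavg_one_exp`).
  CONTRAST ✓`QSym_gaugeDir` (`QSym 1 (D(1)λ) = D̄(λ∘x̂)`, PINNED): the comb frames replace the base-point value by a box mean, so `N_c(1)` is an AVERAGED class.
LOCATED WITH IT — THE HALF-BLOCK OFFSET (recorded, not proved here): the box of `Q′ = QpIter L 1 · (K−n)` read at `coordT3 y` is print's CORNER-anchored `x̂ y + [0, L^{K−n})³`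
(`transl` adds labels, `boxVec ∈ [0,L)ᵈ`, `x₀ = basePt = embIter (K−n) 0` has label `(L^{K−n}−1)∕2` by `TorusGeometry.val_emb`), whereas the T³ block of the inner average and of the S
objects (`QTwS 1 (D(1)λ) = D̄(siteAvgIter (K−n) λ)` by ✓`QTwS_one_apply` ∘ lit ✓`B5Eq120IterProof.bondAvgIter_grad`; `TorusGeometry.val_blockSite`) is `[L^{K−n}·y, L^{K−n}·y + L^{K−n})³`,
CENTRED at `x̂ y`.  The two averaged classes are over partitions offset by half a block, so `N_c(1) ≠ N_S(1)` and `Rc 1 ≠ RS 1` in general: row (hR) of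
✓`Prop7LaplaceAcFlatTransfer.coercive_laplaceAc_one_of_sliceBound` is to be used CONJUGATED by the half-block lattice translation (the comb flat form is the translate of
the S form plus a gradient-blind third-square shift), not verbatim — LOCATE memo addendum (F*).
HONEST FRAMING.  Nothing of COMB-FLAT COERCIVITY's content (I3), of HESS ∕ E′ ∕ EX ∕ the crux K1 is proved; rung R3, not Clay; YM gap NOT proved.  `--supports stmt-QuantumFields-19200 --as helper`.
References: T. Bałaban, CMP 99 (1985) 389–434 [Balaban1985BackgroundPropagators] ((3.19) p.393, p.394, (3.113)–(3.115) p.418); CMP 98 (1985) 17–51 [Balaban1985Averaging] ((11) p.19,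
(84)–(88) pp.30–31, (92) p.31).
-/

noncomputable section

open scoped Matrix.Norms.L2Operator Topology

namespace Summit.QuantumFields.YangMills.Theorems.Prop7CombChartFlatPureGauge

open NormedSpace Filter
open Literature.MathematicalPhysics.QuantumFieldTheory.Balaban1983to89
open Literature.MathematicalPhysics.QuantumFieldTheory.Balaban1983to89.T3ContinuumYM3Torus
open T4Continuum (transfUp)
open T3LevelShift (siteShift bondShift bondShift_tgt)
open T3PrintedRegularOrbits (sites_eq)
open T3SectALandauChart (bgUnits bgUnits_one)
open B15DeterminingSets (embIter)
open B7Prop1Explicit (expUnit val_expUnit val_inv_expUnit gaugeAct)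
open B7Eq84Concrete (uavg)
open B7Eq99Concrete (wrec)
open B10Eq27TorusAxialLog (pull pull_apply gaugeActT gaugeActT_apply transl)
open B8Thm2SetupTorus (pullGauge pullGauge_apply pull_gaugeActT_eq)
open B7Eq78Linearization (hasDerivAt_mlog_comp hasDerivAt_inverse_comp_one)
open B9Eq3114Proof.P12 (QpIter)
open MatrixLog (mlog)
open Summit.QuantumFields.YangMills.Theorems.Prop7SPrint (basePt)
open Summit.QuantumFields.YangMills.Theorems.Prop7SymAvgGL (descendToGL)
open Summit.QuantumFields.YangMills.Theorems.Prop7QSymFlat (descendToGL_one)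
open Summit.QuantumFields.YangMills.Theorems.Prop7QSymGaugeCovariance (descendToGL_gaugeActT expUnit_chartCurve_eventually hasDerivAt_mlog_conjCurve)
open Summit.QuantumFields.YangMills.Theorems.Prop7FlatHolonomy (transfUp_eq_embIter)
open Summit.QuantumFields.YangMills.Theorems.Prop7AxialReprPrint (embIter_eq_transl)
open Summit.QuantumFields.YangMills.Theorems.Prop7SymAvgTw (coordT3 frameTw dbarTw logChartTw QTw frameTw_def dbarTw_def logChartTw_apply)
open Summit.QuantumFields.YangMills.Theorems.Prop7CombFramesFlatPureGauge (wrec_one_gaugeAct hasDerivAt_uavg_one_exp uavg_one_one)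

variable (F : T3Family) {n K : ℕ} (h : n ≤ K)

/-! ## §1 The frames and the inner average of a flat pure gauge, read on the comparison lattice -/

/-- the based pullback of the trivial configuration is trivial. [cite: Balaban1985Averaging, (8) p.19] -/
theorem pull_const_one (x₀ : Site (F.P K) 0) :
    pull (fun _ : PBond (F.P K) 0 => (1 : (Matrix (Fin 2) (Fin 2) ℂ)ˣ)) x₀ = 1 := by
  funext z μ; rw [pull_apply]; rfl

/-- if `e^{A}·1♭ = 1♭^{g}` then `e^{A} = 1^{g}` as a plain units field. [cite: Balaban1985Averaging, (8) p.19] -/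
theorem expUnit_eq_gaugeActT_one {g : GaugeTransf (F.P K) 0 (Matrix (Fin 2) (Fin 2) ℂ)ˣ} {A : PBond (F.P K) 0 → Matrix (Fin 2) (Fin 2) ℂ}
    (hA : (fun b => expUnit (A b) * bgUnits F K (1 : GaugeField (F.P K) 0 (Matrix.specialUnitaryGroup (Fin 2) ℂ)) b)
      = gaugeActT g (bgUnits F K (1 : GaugeField (F.P K) 0 (Matrix.specialUnitaryGroup (Fin 2) ℂ)))) :
    (fun b => expUnit (A b)) = gaugeActT g (fun _ : PBond (F.P K) 0 => (1 : (Matrix (Fin 2) (Fin 2) ℂ)ˣ)) := by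
  rw [bgUnits_one] at hA
  funext b
  have hb := congrFun hA b
  simp only [mul_one] at hb
  exact hb

/-- ★ **THE COMB FRAME OF A FLAT PURE GAUGE ON T³**: if `e^{A}·1♭ = 1♭^{g}` then `w_A(y) = g(x̂ y) · (R̄₀(g♯⁻¹))^{(K−n)}(coordT3 y)` — ✓`Prop7CombFramesFlatPureGauge.wrec_one_gaugeAct` through the based
pullback (`(1^{g})♯ = 1^{g♯}`, ✓`pull_gaugeActT_eq`) and the canonical coordinates (`x̂ y = x₀ + L^{K−n}·coordT3 y`, ✓`embIter_eq_transl`). [cite: Balaban1985Averaging, (84)–(87) pp.30–31] -/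
theorem frameTw_one_of_gaugeActT (g : GaugeTransf (F.P K) 0 (Matrix (Fin 2) (Fin 2) ℂ)ˣ) (A : PBond (F.P K) 0 → Matrix (Fin 2) (Fin 2) ℂ)
    (hA : (fun b => expUnit (A b) * bgUnits F K (1 : GaugeField (F.P K) 0 (Matrix.specialUnitaryGroup (Fin 2) ℂ)) b)
      = gaugeActT g (bgUnits F K (1 : GaugeField (F.P K) 0 (Matrix.specialUnitaryGroup (Fin 2) ℂ))))
    (y : Site (F.P n) 0) :
    frameTw F n K h (1 : GaugeField (F.P K) 0 (Matrix.specialUnitaryGroup (Fin 2) ℂ)) A y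
      = g (embIter (K - n) (siteShift (sites_eq F n K h) y))
          * uavg (F.P K).L (1 : B7Prop1Explicit.Site (F.P K).d → Fin (F.P K).d → (Matrix (Fin 2) (Fin 2) ℂ)ˣ)
              (pullGauge g (basePt F n K))⁻¹ (K - n) (coordT3 F n K h y) := by
  rw [frameTw_def, bgUnits_one, expUnit_eq_gaugeActT_one F hA, pull_gaugeActT_eq, pull_const_one, wrec_one_gaugeAct, pullGauge_apply]
  congr 2
  exact (embIter_eq_transl (P := F.P K) (by show K - n ≤ F.m + K; omega) (siteShift (sites_eq F n K h) y)).symm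

/-- **THE INNER (PINNED-COVARIANT) AVERAGE OF A FLAT PURE GAUGE**: `D̄_GL(e^{A}·1♭)(c) = g(x̂c₋)·g(x̂c₊)⁻¹` (✓`descendToGL_gaugeActT`, ✓`descendToGL_one`). [cite: Balaban1985Averaging, (11) p.19] -/
theorem descendToGL_one_of_gaugeActT (g : GaugeTransf (F.P K) 0 (Matrix (Fin 2) (Fin 2) ℂ)ˣ) (A : PBond (F.P K) 0 → Matrix (Fin 2) (Fin 2) ℂ)
    (hA : (fun b => expUnit (A b) * bgUnits F K (1 : GaugeField (F.P K) 0 (Matrix.specialUnitaryGroup (Fin 2) ℂ)) b)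
      = gaugeActT g (bgUnits F K (1 : GaugeField (F.P K) 0 (Matrix.specialUnitaryGroup (Fin 2) ℂ))))
    (c : PBond (F.P n) 0) :
    descendToGL F n K h (fun b => expUnit (A b) * bgUnits F K (1 : GaugeField (F.P K) 0 (Matrix.specialUnitaryGroup (Fin 2) ℂ)) b) c
      = g (embIter (K - n) (siteShift (sites_eq F n K h) c.src)) * (g (embIter (K - n) (siteShift (sites_eq F n K h) c.tgt)))⁻¹ := by
  rw [hA, descendToGL_gaugeActT, bgUnits_one, descendToGL_one, transfUp_eq_embIter, transfUp_eq_embIter, mul_one]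

/-! ## §2 ★★★ The twisted double-bar average of a flat pure gauge: the base-point factors cancel -/

/-- ★★★ **`U̿^{tw}(A)(c) = ū(c₋)⁻¹ · ū(c₊)` FOR `e^{A}·1♭ = 1♭^{g}`**, `ū y := (R̄₀(g♭⁻¹))^{(K−n)}(coordT3 y)` — [Balaban1985BackgroundPropagators] p.418 «Ū′_c = (R̄u)(c₋)R̄_c(R̄u)⁻¹(c₊)» (`u = g⁻¹`,
`R̄_c = 1`) at level `K − n` for the route's twisted average: the frames contribute `g(x̂·)·ū(·)` (§1), the inner average `g(x̂c₋)g(x̂c₊)⁻¹` (§1), the background average is `1`, and the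
base-point values cancel. [cite: Balaban1985BackgroundPropagators, (3.113) p.418; Balaban1985Averaging, (88)–(92) p.31] -/
theorem dbarTw_one_of_gaugeActT (g : GaugeTransf (F.P K) 0 (Matrix (Fin 2) (Fin 2) ℂ)ˣ) (A : PBond (F.P K) 0 → Matrix (Fin 2) (Fin 2) ℂ)
    (hA : (fun b => expUnit (A b) * bgUnits F K (1 : GaugeField (F.P K) 0 (Matrix.specialUnitaryGroup (Fin 2) ℂ)) b)
      = gaugeActT g (bgUnits F K (1 : GaugeField (F.P K) 0 (Matrix.specialUnitaryGroup (Fin 2) ℂ))))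
    (c : PBond (F.P n) 0) :
    dbarTw F n K h (1 : GaugeField (F.P K) 0 (Matrix.specialUnitaryGroup (Fin 2) ℂ)) A c
      = (uavg (F.P K).L (1 : B7Prop1Explicit.Site (F.P K).d → Fin (F.P K).d → (Matrix (Fin 2) (Fin 2) ℂ)ˣ) (pullGauge g (basePt F n K))⁻¹ (K - n)
            (coordT3 F n K h c.src))⁻¹
          * uavg (F.P K).L (1 : B7Prop1Explicit.Site (F.P K).d → Fin (F.P K).d → (Matrix (Fin 2) (Fin 2) ℂ)ˣ) (pullGauge g (basePt F n K))⁻¹ (K - n)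
            (coordT3 F n K h c.tgt) := by
  rw [dbarTw_def, frameTw_one_of_gaugeActT F h g A hA, frameTw_one_of_gaugeActT F h g A hA, descendToGL_one_of_gaugeActT F h g A hA, bgUnits_one, descendToGL_one,
    inv_one, mul_one, mul_inv_rev]
  simp only [mul_assoc, inv_mul_cancel_left]

/-- ★ **THE TWISTED LOG-CHART OF A FLAT PURE GAUGE**: `log U̿^{tw}(A)(c) = log(ū(c₋)⁻¹·ū(c₊))`. [cite: Balaban1985BackgroundPropagators, (3.113)–(3.114) p.418] -/
theorem logChartTw_one_of_gaugeActT (g : GaugeTransf (F.P K) 0 (Matrix (Fin 2) (Fin 2) ℂ)ˣ) (A : PBond (F.P K) 0 → Matrix (Fin 2) (Fin 2) ℂ)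
    (hA : (fun b => expUnit (A b) * bgUnits F K (1 : GaugeField (F.P K) 0 (Matrix.specialUnitaryGroup (Fin 2) ℂ)) b)
      = gaugeActT g (bgUnits F K (1 : GaugeField (F.P K) 0 (Matrix.specialUnitaryGroup (Fin 2) ℂ))))
    (c : PBond (F.P n) 0) :
    logChartTw F n K h (1 : GaugeField (F.P K) 0 (Matrix.specialUnitaryGroup (Fin 2) ℂ)) A c
      = mlog ((((uavg (F.P K).L (1 : B7Prop1Explicit.Site (F.P K).d → Fin (F.P K).d → (Matrix (Fin 2) (Fin 2) ℂ)ˣ) (pullGauge g (basePt F n K))⁻¹ (K - n)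
            (coordT3 F n K h c.src))⁻¹
          * uavg (F.P K).L (1 : B7Prop1Explicit.Site (F.P K).d → Fin (F.P K).d → (Matrix (Fin 2) (Fin 2) ℂ)ˣ) (pullGauge g (basePt F n K))⁻¹ (K - n)
            (coordT3 F n K h c.tgt) : (Matrix (Fin 2) (Fin 2) ℂ)ˣ)) : Matrix (Fin 2) (Fin 2) ℂ) := by
  rw [logChartTw_apply, dbarTw_one_of_gaugeActT F h g A hA]

/-! ## §3 ★★★ (3.115) at the flat member for the twisted average: `QTw 1` on gauge directions sees the BLOCK MEAN -/

variable {F h}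

/-- ★★★ **`QTw 1 (D(1)λ)(c) = (Q′_{K−n}(−λ♯))(z c₊) − (Q′_{K−n}(−λ♯))(z c₋)`** (`= (Q′λ♯)(z c₋) − (Q′λ♯)(z c₊)` by linearity of `Q′`): for EVERY `λ : sites → M₂(ℂ)`, the twisted linearised
average of the flat gauge direction `(D(1)λ)(b) = λ(b₋) − λ(b₊)` is the coarse flat gradient of the ITERATED BLOCK MEAN `Q′ = QpIter L 1 · (K−n)` of the pulled-back parameter
`λ♯ = λ ∘ transl x₀` — print's (3.115) for the route's `QTw` at `U₀ = 1`.  Chain rule along `g_t = e^{tλ}` (chart parameter `A_t`, ✓`expUnit_chartCurve_eventually`,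
✓`hasDerivAt_mlog_conjCurve`), §2 along the curve (`ū_t = R̄₀(e^{−tλ♯})^{(K−n)}`), ✓`hasDerivAt_uavg_one_exp`, uniqueness of the derivative; differentiability of `logChartTw 1` at `0`
DISPLAYED (`hQ`). [cite: Balaban1985BackgroundPropagators, (3.114)–(3.115) p.418, (3.19) p.393; Balaban1985Averaging, (84)–(88) pp.30–31] -/
theorem QTw_one_gaugeDir (hQ : DifferentiableAt ℂ (logChartTw F n K h (1 : GaugeField (F.P K) 0 (Matrix.specialUnitaryGroup (Fin 2) ℂ))) 0)
    (lam : Site (F.P K) 0 → Matrix (Fin 2) (Fin 2) ℂ) :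
    QTw F n K h (1 : GaugeField (F.P K) 0 (Matrix.specialUnitaryGroup (Fin 2) ℂ)) (fun b : PBond (F.P K) 0 => lam b.src - lam b.tgt)
      = fun c : PBond (F.P n) 0 =>
          QpIter (F.P K).L (1 : B7Prop1Explicit.Site (F.P K).d → Fin (F.P K).d → (Matrix (Fin 2) (Fin 2) ℂ)ˣ) (fun z => -lam (transl (basePt F n K) z)) (K - n)
              (coordT3 F n K h c.tgt)
            - QpIter (F.P K).L (1 : B7Prop1Explicit.Site (F.P K).d → Fin (F.P K).d → (Matrix (Fin 2) (Fin 2) ℂ)ˣ) (fun z => -lam (transl (basePt F n K) z)) (K - n)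
              (coordT3 F n K h c.src) := by
  have hL : 1 ≤ (F.P K).L := le_of_lt F.hL.2
  -- the chart parameter of the gauge curve and its derivative at 0 (as in ✓`QSym_gaugeDir`, at `U₀ = 1`)
  set U₁ : GaugeField (F.P K) 0 (Matrix.specialUnitaryGroup (Fin 2) ℂ) := 1 with hU₁
  set A : ℂ → PBond (F.P K) 0 → Matrix (Fin 2) (Fin 2) ℂ := fun t b =>
    mlog (exp (t • lam b.src) * ((bgUnits F K U₁ b : (Matrix (Fin 2) (Fin 2) ℂ)ˣ) : Matrix (Fin 2) (Fin 2) ℂ) * exp (t • (-lam b.tgt))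
      * (((bgUnits F K U₁ b)⁻¹ : (Matrix (Fin 2) (Fin 2) ℂ)ˣ) : Matrix (Fin 2) (Fin 2) ℂ)) with hAdef
  have hA0 : A 0 = 0 := by
    funext b
    show mlog (exp ((0 : ℂ) • lam b.src) * _ * exp ((0 : ℂ) • (-lam b.tgt)) * _) = 0
    rw [Prop7QSymGaugeCovariance.conjCurve_zero, Units.mul_inv, MatrixLog.mlog_one]
  have hA' : HasDerivAt A (fun b : PBond (F.P K) 0 => lam b.src - lam b.tgt) 0 := by
    rw [hasDerivAt_pi]
    intro b
    refine (hasDerivAt_mlog_conjCurve (lam b.src) (lam b.tgt) (bgUnits F K U₁ b)).congr_deriv ?_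
    rw [hU₁, bgUnits_one]
    simp
  -- the chain rule through the twisted log-chart
  have hQ' : HasFDerivAt (logChartTw F n K h U₁) (QTw F n K h U₁) (A 0) := by rw [hA0]; exact hQ.hasFDerivAt
  have hchain : HasDerivAt (fun t => logChartTw F n K h U₁ (A t)) (QTw F n K h U₁ (fun b : PBond (F.P K) 0 => lam b.src - lam b.tgt)) 0 :=
    hQ'.comp_hasDerivAt (0 : ℂ) hA'
  -- §2 along the curve: the explicit value near `t = 0`
  set ubar : ℂ → Site (F.P n) 0 → Matrix (Fin 2) (Fin 2) ℂ := fun t y =>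
    ((uavg (F.P K).L (1 : B7Prop1Explicit.Site (F.P K).d → Fin (F.P K).d → (Matrix (Fin 2) (Fin 2) ℂ)ˣ)
      (fun z => expUnit (t • (-lam (transl (basePt F n K) z)))) (K - n) (coordT3 F n K h y) : (Matrix (Fin 2) (Fin 2) ℂ)ˣ) : Matrix (Fin 2) (Fin 2) ℂ) with hubar
  have hinv : ∀ t : ℂ, (pullGauge (fun x => expUnit (t • lam x)) (basePt F n K))⁻¹
      = fun z => expUnit (t • (-lam (transl (basePt F n K) z))) := by
    intro t; funext z; rw [Pi.inv_apply, pullGauge_apply, val_inv_expUnit, smul_neg]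
  have hubar0 : ∀ y, ubar 0 y = 1 := by
    intro y
    have h1 : (fun z => expUnit ((0 : ℂ) • (-lam (transl (basePt F n K) z))))
        = (1 : B7Prop1Explicit.Site (F.P K).d → (Matrix (Fin 2) (Fin 2) ℂ)ˣ) := funext fun z => Units.ext (by simp)
    simp only [hubar, h1, uavg_one_one, Pi.one_apply, Units.val_one]
  have hubar' : ∀ y, HasDerivAt (fun t => ubar t y)
      (QpIter (F.P K).L (1 : B7Prop1Explicit.Site (F.P K).d → Fin (F.P K).d → (Matrix (Fin 2) (Fin 2) ℂ)ˣ) (fun z => -lam (transl (basePt F n K) z)) (K - n)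
        (coordT3 F n K h y)) 0 :=
    fun y => hasDerivAt_uavg_one_exp (F.P K).L hL (fun z => -lam (transl (basePt F n K) z)) (K - n) (coordT3 F n K h y)
  set ψ : ℂ → PBond (F.P n) 0 → Matrix (Fin 2) (Fin 2) ℂ := fun t c => mlog (Ring.inverse (ubar t c.src) * ubar t c.tgt) with hψ
  have hψ' : HasDerivAt ψ (fun c : PBond (F.P n) 0 =>
      QpIter (F.P K).L (1 : B7Prop1Explicit.Site (F.P K).d → Fin (F.P K).d → (Matrix (Fin 2) (Fin 2) ℂ)ˣ) (fun z => -lam (transl (basePt F n K) z)) (K - n)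
          (coordT3 F n K h c.tgt)
        - QpIter (F.P K).L (1 : B7Prop1Explicit.Site (F.P K).d → Fin (F.P K).d → (Matrix (Fin 2) (Fin 2) ℂ)ˣ) (fun z => -lam (transl (basePt F n K) z)) (K - n)
          (coordT3 F n K h c.src)) 0 := by
    rw [hasDerivAt_pi]
    intro c
    have h1 := hasDerivAt_inverse_comp_one (hubar0 c.src) (hubar' c.src)
    have h2 := hubar' c.tgt
    have h12 := h1.mul h2
    have h0 : Ring.inverse (ubar 0 c.src) * ubar 0 c.tgt = 1 := by rw [hubar0, hubar0, Ring.inverse_one, one_mul]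
    refine (hasDerivAt_mlog_comp h0 h12).congr_deriv ?_
    rw [hubar0, hubar0, Ring.inverse_one, mul_one, one_mul, neg_add_eq_sub]
  have hev : (fun t => logChartTw F n K h U₁ (A t)) =ᶠ[𝓝 0] ψ := by
    filter_upwards [expUnit_chartCurve_eventually (F := F) U₁ lam] with t ht
    funext c
    rw [hU₁] at ht
    rw [hU₁, logChartTw_one_of_gaugeActT F h (fun x => expUnit (t • lam x)) (A t) ht c, hψ, hinv t]
    simp only [hubar, Units.val_mul, Ring.inverse_unit]
  exact (hchain.congr_of_eventuallyEq hev.symm).unique hψ'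

/-! ## §4 (v1.1, APPEND) The differentiability row `hQ` DISCHARGED at the trivially regular flat member; (3.115)-flat unconditional -/

/-- **`log U̿^{tw}` IS DIFFERENTIABLE AT `0` AT THE FLAT MEMBER** — ✓`Prop7SymAvgTwBridge.hasFDerivAt_logChartTw` with its two rows supplied by ✓`Prop7SymAvgRelDiffT3.hasFDerivAt_rel_of_regPr` and
✓`Prop7SymAvgTwFrameDiff.hasFDerivAt_frameTw_of_regPr` at `U₀ = 1`, printed-regular at every radius (lit ✓`T3PrintedRegularMinimiser.regPr_one`); the radius `ε₀ := 1∕(10⁸L³)` meets the four numeric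
windows (`10⁷L³ε₀ ≤ 1`, `C0·2ε₀ ≤ ⅓`, `8ε₀ ≤ c2′`, `exp(4·800·16·7·2ε₀) < 2`; `C0 3 = 226·224²`, `c2′ 3 L = 1∕(14336L²)`, `L ≥ 3`). [cite: Balaban1985BackgroundPropagators, (3.13)–(3.14) p.393; Balaban1985Averaging, Prop. 2 p.22] -/
theorem differentiableAt_logChartTw_one :
    DifferentiableAt ℂ (logChartTw F n K h (1 : GaugeField (F.P K) 0 (Matrix.specialUnitaryGroup (Fin 2) ℂ))) 0 := by
  have hL1 : 1 < F.L := F.hL.2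
  have hL3 : (3 : ℝ) ≤ F.L := by
    obtain ⟨k, hk⟩ := F.hL.1
    have : 3 ≤ F.L := by omega
    exact_mod_cast this
  set ε₀ : ℝ := 1 / (10 ^ 8 * (F.L : ℝ) ^ 3) with hε₀def
  have hL3' : (27 : ℝ) ≤ (F.L : ℝ) ^ 3 := by
    have h9 : (9 : ℝ) ≤ (F.L : ℝ) ^ 2 := by nlinarith [hL3]
    nlinarith [h9, hL3]
  have hε₀ : 0 < ε₀ := by positivity
  have hε₀le : ε₀ ≤ 1 / (27 * 10 ^ 8) := by
    rw [hε₀def]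
    exact one_div_le_one_div_of_le (by norm_num) (by nlinarith [hL3'])
  have hε : 10 ^ 7 * (F.L : ℝ) ^ 3 * ε₀ ≤ 1 := by
    rw [hε₀def, ← mul_div_assoc, mul_one, div_le_one (by positivity)]
    nlinarith [hL3']
  have hα3 : B7Prop2Explicit.C0 (F.P K).d * (2 * ε₀) ≤ 1 / 3 := by
    show B7Prop2Explicit.C0 3 * (2 * ε₀) ≤ 1 / 3
    unfold B7Prop2Explicit.C0
    nlinarith [hε₀le]
  have hα4 : 4 * (2 * ε₀) ≤ B7Prop2Explicit.c2' (F.P K).d (F.P K).L := by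
    show 4 * (2 * ε₀) ≤ B7Prop2Explicit.c2' 3 F.L
    unfold B7Prop2Explicit.c2'
    rw [hε₀def, show (4 : ℝ) * (2 * (1 / (10 ^ 8 * (F.L : ℝ) ^ 3))) = 8 / (10 ^ 8 * (F.L : ℝ) ^ 3) by ring,
      div_le_div_iff₀ (by positivity) (by positivity)]
    push_cast
    nlinarith [mul_nonneg (sq_nonneg (F.L : ℝ)) (show (0 : ℝ) ≤ 10 ^ 8 * (F.L : ℝ) - 114688 by linarith)]
  have hexp : Real.exp (4 * (800 * (((F.P K).d : ℝ) + 1) ^ 2 * (((F.P K).d : ℝ) + 4)) * (2 * ε₀)) < 2 := by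
    have hd : ((F.P K).d : ℝ) = 3 := by norm_num [T3Family.P_d]
    rw [hd]
    have hx : 4 * (800 * ((3 : ℝ) + 1) ^ 2 * ((3 : ℝ) + 4)) * (2 * ε₀) < Real.log 2 := by
      have := Real.log_two_gt_d9
      nlinarith [hε₀le]
    calc Real.exp (4 * (800 * ((3 : ℝ) + 1) ^ 2 * ((3 : ℝ) + 4)) * (2 * ε₀))
        < Real.exp (Real.log 2) := Real.exp_lt_exp.2 hx
      _ = 2 := Real.exp_log (by norm_num)
  have hreg := T3PrintedRegularMinimiser.regPr_one (F := F) (n := n) (K := K) hε₀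
  exact (Prop7SymAvgTwBridge.hasFDerivAt_logChartTw F h (1 : GaugeField (F.P K) 0 (Matrix.specialUnitaryGroup (Fin 2) ℂ))
    (Prop7SymAvgRelDiffT3.hasFDerivAt_rel_of_regPr F h hε₀ hε _ hreg)
    (Prop7SymAvgTwFrameDiff.hasFDerivAt_frameTw_of_regPr F h hε₀ hα3 hα4 hexp _ hreg)).differentiableAt

/-- ★★★ **(3.115) AT THE FLAT MEMBER FOR THE ROUTE'S TWISTED AVERAGE, UNCONDITIONAL**: `QTw F n K h 1 (b ↦ λ(b₋) − λ(b₊)) = c ↦ (Q′(−λ♯))(z c₊) − (Q′(−λ♯))(z c₋)` (§3 with `hQ` discharged by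
`differentiableAt_logChartTw_one`). [cite: Balaban1985BackgroundPropagators, (3.114)–(3.115) p.418, (3.19) p.393] -/
theorem QTw_one_gaugeDir' (lam : Site (F.P K) 0 → Matrix (Fin 2) (Fin 2) ℂ) :
    QTw F n K h (1 : GaugeField (F.P K) 0 (Matrix.specialUnitaryGroup (Fin 2) ℂ)) (fun b : PBond (F.P K) 0 => lam b.src - lam b.tgt)
      = fun c : PBond (F.P n) 0 =>
          QpIter (F.P K).L (1 : B7Prop1Explicit.Site (F.P K).d → Fin (F.P K).d → (Matrix (Fin 2) (Fin 2) ℂ)ˣ) (fun z => -lam (transl (basePt F n K) z)) (K - n)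
              (coordT3 F n K h c.tgt)
            - QpIter (F.P K).L (1 : B7Prop1Explicit.Site (F.P K).d → Fin (F.P K).d → (Matrix (Fin 2) (Fin 2) ℂ)ˣ) (fun z => -lam (transl (basePt F n K) z)) (K - n)
              (coordT3 F n K h c.src) :=
  QTw_one_gaugeDir (differentiableAt_logChartTw_one (F := F) (h := h)) lam

end Summit.QuantumFields.YangMills.Theorems.Prop7CombChartFlatPureGauge

end
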